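import Summits.BirchSwinnertonDyer.BirchSwinnertonDyer.Theorems.ErratumRoadFiveNonSurjCornerHybridFourStubs
import Summits.BirchSwinnertonDyer.BirchSwinnertonDyer.Theorems.ErratumRoadFiveNonSurjCornerHybridTwinMuAnDeepHida
import Summits.BirchSwinnertonDyer.BirchSwinnertonDyer.Theorems.ErratumRoadFiveNonSurjCornerHybridDeepWitnessHida
import HarnessLib

/-!
# Route `ErratumRoadFive` (rung K2), crux `NonSurjCorner` (item stmt-BirchSwinnertonDyer-19065), line `Lines/hybrid.lean`:
# THE CRUX FROM ROUTE ITEMS BY NAME plus ONE displayed print name — the composition behind line edition r25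
# (cell `bsd-stepL`, seat `bsd-stepL-corner-p1` g20; `--supports stmt-BirchSwinnertonDyer-19065 --as helper`)

WHY THIS FILE. After r24′ (four registered stubs: two research-grade ∃-stubs `stub_deepWitness57` ∕ `stub_twinLowerSupply57`, two
CITABLE bundles `stub_twinFactsFifteen57` (15 names) ∕ `stub_cornerShimuraFacts57` (2 + 4 names)) every binder of glue #26
(`nonSurjCorner_of_deepWitness_of_twinLowerSupply_of_fifteenFacts_of_twoPlusFourNames_pAnchor`, p662125) is implied by a DECLARATION OF
THE ROUTE FILE `Theses/ErratumRoadFive.lean` — except one print name: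
* slot 1′ (ONE deep witness per deep corner pair) ⟸ the gen-3 children `NonSurjCornerKolyZDeep` (23046) ∧ `NonSurjCornerTwinMuAnDeep` (23047)
  with modularity, Mazur 1978 Cor. 4.1 and the one-prime Friedberg–Hoffstein fact, all three conjuncts of `KatoTwinFactsFiveAnContra` (23048)
  — `deepWitness_of_kolyZShaAn_of_twinMuAnDeep` (g18, `…HybridDeepWitnessHida`);
* slot 2″ (the two twin-lower supplies) ⟸ crux `X11aLowerHalf` (19064) with GZK, modularity, the two Friedberg–Hoffstein facts
  — `twinLowerSupply_of_x11aLowerHalf` (g18, `…HybridSupplyKeyed`); the inert Friedberg–Hoffstein fact is conjunct 13 of `PublishedInputsFive` (19066);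
* slot 3 = `KatoTwinFactsFiveAnContra` (23048) VERBATIM; slot 5 conjunct 1 = `EulerHalfGrossPrintFacts` (27981) VERBATIM; slot 5 conjunct 2 =
  conjunct 13 of 19066 ∧ `ShimuraParametrizationDataNonempty` (19524) ∧ `PastenComponentOrdersInput` (19716) ∧ ‹the printed CM primitives of
  `X_{N⁺,N⁻}` for IRREDUCIBLE `E[p]`, `Literature.….shimuraCurve_heegnerSystem_primitivesFromFiveIrr` — NOT (yet) a route item; displayed›.
So `nonSurjCorner_of_items_r25` states the crux with EIGHT route decls BY NAME and that one Literature name. It is what RULING 72 asks of a line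
(print inputs item-stated BY NAME, entering `_of` as item hypotheses) and is the composition of the line's edition r25 (ONE one-name cite stub;
zero stubs once the planner item-states the primitives name, cf. `ClassRecordThree.ShimuraPrimitivesAtThreeInertFact` = item 23334's sibling 23177).
Every ingredient is a landed theorem of this seat's g18 ∕ g19; nothing new is proved about any curve.

HONEST FRAMING: ONE THEOREM (composition only; no definition, no named fact minted, no `sorry`); CONDITIONAL on eight OPEN ∕ cite-only route items
(two research-grade cruxes 23046 ∕ 23047 — Kolyvagin's refined conjecture and Greenberg's μ = 0 at a non-surjective irreducible image with `p ∥ N`,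
beyond print —, crux 19064, and printed inputs) and one displayed print name; 19065 is NOT closed by this file; no census word, tier or label
moves (T7); BSD is proved for no curve. [cite: Cha2005, Thm. 21 and Rmk. 25] [cite: Miller2011LMS, Def. 1.1] [cite: CaiShuTian2014, Thm. 1.5]
-/

set_option autoImplicit false
set_option linter.dupNamespace false -- `Summit.BirchSwinnertonDyer.BirchSwinnertonDyer` (summit = problem), tree-wide

noncomputable section

open scoped Classical NumberField

namespace Summit.BirchSwinnertonDyer.BirchSwinnertonDyer.Theorems

open WeierstrassCurve NumberField
  Literature.NumberTheory.EllipticCurves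
  Literature.NumberTheory.EllipticCurves.ModularForms
  Literature.NumberTheory.Automorphic
  Literature.NumberTheory.EllipticCurves.Rank1Residual
  Literature.NumberTheory.EllipticCurves.Rank1Residual.Typed
  Summit.BirchSwinnertonDyer.Rank1Residual

/-- **`NonSurjCorner` FROM EIGHT ROUTE ITEMS BY NAME + ONE PRINT NAME** (line `hybrid` r25's composition). Binders, in order: the two DEEP
children 23046 `NonSurjCornerKolyZDeep` (refined-Kolyvagin certificates at the deep frames of the deep corner pairs) and 23047
`NonSurjCornerTwinMuAnDeep` (analytic μ = 0 at the Friedberg–Hoffstein twins of the deep pairs), the fifteen print facts 23048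
`KatoTwinFactsFiveAnContra`, crux 19064 `X11aLowerHalf` (supplies both twin-lower halves a fortiori), 19066 `PublishedInputsFive`
(conjunct 13: Friedberg–Hoffstein inert twist), 27981 `EulerHalfGrossPrintFacts`, 19524 `ShimuraParametrizationDataNonempty`, 19716
`PastenComponentOrdersInput`, and the displayed Literature name `shimuraCurve_heegnerSystem_primitivesFromFiveIrr` (Cai–Shu–Tian ∕ Nekovář ∕ Gross ∕ BD96
primitives for irreducible `E[p]`; no route item yet). Proof: glue #26 with slot 1′ := `deepWitness_of_kolyZShaAn_of_twinMuAnDeep` and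
slot 2″ := `twinLowerSupply_of_x11aLowerHalf`. CONDITIONAL; 19065 NOT closed by this file; T7.
[cite: Cha2005, Thm. 21 and Rmk. 25] [cite: FriedbergHoffstein1995, Thm. B] [cite: Mazur1978, Cor. 4.1] [cite: Miller2011LMS, Def. 1.1] -/
theorem nonSurjCorner_of_items_r25
    (hZ : Summit.BirchSwinnertonDyer.BirchSwinnertonDyer.Theses.ErratumRoadFive.NonSurjCornerKolyZDeep)
    (hμ : Summit.BirchSwinnertonDyer.BirchSwinnertonDyer.Theses.ErratumRoadFive.NonSurjCornerTwinMuAnDeep)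
    (hF : Summit.BirchSwinnertonDyer.BirchSwinnertonDyer.Theses.ErratumRoadFive.KatoTwinFactsFiveAnContra)
    (h₃ : Summit.BirchSwinnertonDyer.BirchSwinnertonDyer.Theses.ErratumRoadFive.X11aLowerHalf)
    (h₅ : Summit.BirchSwinnertonDyer.BirchSwinnertonDyer.Theses.ErratumRoadFive.PublishedInputsFive)
    (hGr : Summit.BirchSwinnertonDyer.BirchSwinnertonDyer.Theses.ErratumRoadFive.EulerHalfGrossPrintFacts)
    (hJL : Summit.BirchSwinnertonDyer.BirchSwinnertonDyer.Theses.ErratumRoadFive.ShimuraParametrizationDataNonempty)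
    (hCO : Summit.BirchSwinnertonDyer.BirchSwinnertonDyer.Theses.ErratumRoadFive.PastenComponentOrdersInput)
    (hPrim : shimuraCurve_heegnerSystem_primitivesFromFiveIrr) :
    Summit.BirchSwinnertonDyer.BirchSwinnertonDyer.Theses.ErratumRoadFive.NonSurjCorner := by
  obtain ⟨-, -, -, hGZK, hnf, hFHs, hMaz, -⟩ := id hF
  -- conjunct 13 of `PublishedInputsFive`: the inert Friedberg–Hoffstein twist
  have hFHi : friedbergHoffstein_exists_twist_ne_zero_inertAt := h₅.2.2.2.2.2.2.2.2.2.2.2.2.1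
  exact nonSurjCorner_of_deepWitness_of_twinLowerSupply_of_fifteenFacts_of_twoPlusFourNames_pAnchor
    (deepWitness_of_kolyZShaAn_of_twinMuAnDeep hnf hMaz hFHs hZ hμ)
    (twinLowerSupply_of_x11aLowerHalf hGZK (hasEntireLFunction_rat_of_exists_isNewformOf hnf) hnf hFHs hFHi h₃)
    hF hGr ⟨hFHi, hJL, hCO, hPrim⟩

end Summit.BirchSwinnertonDyer.BirchSwinnertonDyer.Theorems

end
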